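import Summits.Ventures.LatticeQCDFlow.Exactness.FlowSamplerSquareIntegrableCeiling
import HarnessLib

/-!
# TERMWISE GEOMETRIC DECORRELATION: a positive sampler with a Poincaré inequality has `C(k+1) ≤ (1−γ) C(k)`; under a weight bound the flow arm decorrelates every square-integrable observable at rate `1 − Z/C`

HONEST FRAMING: exact (Metropolis-corrected) sampling algorithms for lattice gauge theory;
figures of merit are autocorrelation/cost numbers at stated couplings and volumes; no
continuum-physics claim.  (SCALAR calibration rung S0-A: not a gauge result.)

Venture `LatticeQCDFlow` (cell pub-lqcd), topic `Exactness`; FANOUT row 2 (`s0-phi4`, FLOW arm).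
NEW WORK of the cell at the format level (`RevOp`, no spectral theorem: parity + Cauchy–Schwarz for
the positive form `kform_sq_le_of_pos`) and its flow-arm instance on `L²(w)` over
`FlowSamplerSquareIntegrableCeiling` (Poincaré inequality `(Z/C)‖v‖² ≤ 𝓔(v)` from `w ≤ C q̃`).
Nothing is cited as a fact.  Printed counterparts NAMED ONLY: Mengersen–Tweedie 1996 Thm 2.1 (total
variation rate `(1 − 1/W)ᵏ`); the tree's bounded-observable version is `FlowSamplerSpectralGap`
(`∫ (Kᵏg)² w ≤ (1 − Z/C)^{2k} ∫ g² w`).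

## What is proved

* **`RevOp.autocov_succ_le_mul_of_poincare_of_pos`** — `RevOp` format with `1 ∈ A`, `K 1 = 1`,
  (pos), and `∫ v (K v) w ≤ θ ∫ v² w` for every CENTRED `v ∈ A` (`0 ≤ θ`): for every centred `u ∈ A`
  and every lag, `C_u(k+1) ≤ θ C_u(k)` (even lags: the hypothesis at `Kᵐu`; odd lags: Cauchy–Schwarz
  for the `K`-form, `⟨v,K²v⟩² ≤ ⟨v,Kv⟩·θ⟨v,K²v⟩`); **`RevOp.autocov_le_pow_of_poincare_of_pos`** —
  `C_u(k) ≤ θᵏ C_u(0)`;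
* **`imhOp_autocov_le_pow_weightBound_of_sq`** — flow arm, `w ≤ C q`, `g` centred measurable
  square-integrable: `C_g(k) ≤ (1 − Z/C)ᵏ ∫ g² w` for every `k` — every square-integrable observable
  (the magnetisation included) decorrelates geometrically at the Mengersen–Tweedie rate.

NOT CLAIMED: a weight bound for any trained network; lower bounds on the rate (those are the floors
`ρ(k) ≥ ρ(1)ᵏ ≥ r̄ᵏ` of the positive-sampler files); anything for HMC / local Metropolis.
-/

namespace Summit.Ventures.LatticeQCDFlow.Exactness

open Real MeasureTheory Filter Finset Set
open Summit.Ventures.LatticeQCDFlow.Scoring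

namespace RevOp

variable {X : Type*} [MeasurableSpace X] {μ : Measure X} {w : X → ℝ} {A : (X → ℝ) → Prop}
  {K : (X → ℝ) → (X → ℝ)}

/-- Iterates of a centred observable stay centred (`K 1 = 1` and symmetry against `1 ∈ A`). -/
theorem iterate_centred (hA1 : A (fun _ => (1 : ℝ)))
    (hAK : ∀ ⦃f : X → ℝ⦄, A f → A (K f))
    (hsymm : ∀ ⦃f h : X → ℝ⦄, A f → A h →
      ∫ x, K f x * h x * w x ∂μ = ∫ x, f x * K h x * w x ∂μ)
    (hunit : ∀ x, K (fun _ => (1 : ℝ)) x = 1) {u : X → ℝ} (hu : A u)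
    (hu0 : ∫ x, u x * w x ∂μ = 0) : ∀ m : ℕ, ∫ x, (K^[m] u) x * w x ∂μ = 0
  | 0 => by simpa using hu0
  | m + 1 => by
    have hv := iterate_mem hAK m hu
    have h := hsymm hv hA1
    simp only [hunit, mul_one] at h
    rw [Function.iterate_succ_apply', h]
    exact iterate_centred hA1 hAK hsymm hunit hu hu0 m

/-- **TERMWISE GEOMETRIC DECAY for a positive sampler with a Poincaré inequality**: if
`∫ v (K v) w ≤ θ ∫ v² w` for every centred `v ∈ A` (`θ ≥ 0`) and `K` is positive on `A`, then for
every centred `u ∈ A` and every lag `k`: `C_u(k+1) ≤ θ · C_u(k)`. -/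
theorem autocov_succ_le_mul_of_poincare_of_pos (hw0 : ∀ x, 0 ≤ w x) (hA1 : A (fun _ => (1 : ℝ)))
    (hAi : ∀ ⦃f h : X → ℝ⦄, A f → A h → Integrable (fun x => f x * h x * w x) μ)
    (hAc : ∀ ⦃f h : X → ℝ⦄ (c : ℝ), A f → A h → A (fun x => f x + c * h x))
    (hAK : ∀ ⦃f : X → ℝ⦄, A f → A (K f))
    (hlin : ∀ ⦃f h : X → ℝ⦄ (c : ℝ), A f → A h →
      ∀ x, K (fun s => f s + c * h s) x = K f x + c * K h x)
    (hsymm : ∀ ⦃f h : X → ℝ⦄, A f → A h →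
      ∫ x, K f x * h x * w x ∂μ = ∫ x, f x * K h x * w x ∂μ)
    (hpos : ∀ ⦃f : X → ℝ⦄, A f → 0 ≤ ∫ x, f x * K f x * w x ∂μ)
    (hunit : ∀ x, K (fun _ => (1 : ℝ)) x = 1) {θ : ℝ} (hθ : 0 ≤ θ)
    (hPoinc : ∀ ⦃v : X → ℝ⦄, A v → ∫ x, v x * w x ∂μ = 0 →
      ∫ x, v x * K v x * w x ∂μ ≤ θ * ∫ x, v x ^ 2 * w x ∂μ)
    {u : X → ℝ} (hu : A u) (hu0 : ∫ x, u x * w x ∂μ = 0) (k : ℕ) :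
    ∫ x, u x * (K^[k + 1] u) x * w x ∂μ ≤ θ * ∫ x, u x * (K^[k] u) x * w x ∂μ := by
  obtain ⟨m, rfl | rfl⟩ := Nat.even_or_odd' k
  · -- even lag `2m`: the hypothesis at the centred iterate `v = Kᵐ u`
    have hv := iterate_mem hAK m hu
    have hv0 := iterate_centred hA1 hAK hsymm hunit hu hu0 m
    have h := hPoinc hv hv0
    rw [← Nat.add_zero (2 * m), ← autocov_shift hAK hsymm hu m 0,
      show 2 * m + 0 + 1 = 2 * m + 1 by ring, ← autocov_shift hAK hsymm hu m 1]
    simp only [Function.iterate_zero, id_eq, Function.iterate_one, sq] at h ⊢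
    simpa only [sq] using h
  · -- odd lag `2m+1`: Cauchy–Schwarz for the `K`-form with `v = Kᵐ u`, `Kv`
    have hv := iterate_mem hAK m hu
    have hKv := hAK hv
    have hKv0 := iterate_centred hA1 hAK hsymm hunit hu hu0 (m + 1)
    rw [Function.iterate_succ_apply'] at hKv0
    have hCS := kform_sq_le_of_pos hAi hAc hAK hlin hsymm hpos hv hKv
    -- `⟨Kv, K(Kv)⟩ ≤ θ ‖Kv‖² = θ ⟨v, K²v⟩`
    have hP2 := hPoinc hKv hKv0
    have e2 : ∫ x, K (K^[m] u) x ^ 2 * w x ∂μ = ∫ x, (K^[m] u) x * K (K (K^[m] u)) x * w x ∂μ := by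
      have h := two_time hAK hsymm hv 1 1
      simp only [Function.iterate_succ_apply', Function.iterate_zero, id_eq] at h
      rw [← h]
      simp only [sq]
    rw [e2] at hP2
    set a := ∫ x, (K^[m] u) x * K (K^[m] u) x * w x ∂μ with ha
    set b := ∫ x, (K^[m] u) x * K (K (K^[m] u)) x * w x ∂μ with hb
    have ha0 : 0 ≤ a := hpos hv
    have hb0 : 0 ≤ b := by
      have h0 : 0 ≤ ∫ x, K (K^[m] u) x ^ 2 * w x ∂μ :=
        integral_nonneg fun x => mul_nonneg (sq_nonneg _) (hw0 x)
      rwa [e2] at h0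
    -- `b² ≤ a · (θ b)` hence `b ≤ θ a`
    have hbb : b ^ 2 ≤ a * (θ * b) := hCS.trans (mul_le_mul_of_nonneg_left hP2 ha0)
    have hgoal : b ≤ θ * a := by
      rcases eq_or_lt_of_le hb0 with hbz | hbpos
      · rw [← hbz]; exact mul_nonneg hθ ha0
      · exact le_of_mul_le_mul_right (by nlinarith [hbb]) hbpos
    rw [← autocov_shift hAK hsymm hu m 1, show 2 * m + 1 + 1 = 2 * m + 2 by ring,
      ← autocov_shift hAK hsymm hu m 2]
    simp only [Function.iterate_succ_apply', Function.iterate_zero, id_eq]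
    exact hgoal

/-- **`C_u(k) ≤ θᵏ C_u(0)`** for every centred `u ∈ A` (iterate the one-step decay). -/
theorem autocov_le_pow_of_poincare_of_pos (hw0 : ∀ x, 0 ≤ w x) (hA1 : A (fun _ => (1 : ℝ)))
    (hAi : ∀ ⦃f h : X → ℝ⦄, A f → A h → Integrable (fun x => f x * h x * w x) μ)
    (hAc : ∀ ⦃f h : X → ℝ⦄ (c : ℝ), A f → A h → A (fun x => f x + c * h x))
    (hAK : ∀ ⦃f : X → ℝ⦄, A f → A (K f))
    (hlin : ∀ ⦃f h : X → ℝ⦄ (c : ℝ), A f → A h →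
      ∀ x, K (fun s => f s + c * h s) x = K f x + c * K h x)
    (hsymm : ∀ ⦃f h : X → ℝ⦄, A f → A h →
      ∫ x, K f x * h x * w x ∂μ = ∫ x, f x * K h x * w x ∂μ)
    (hpos : ∀ ⦃f : X → ℝ⦄, A f → 0 ≤ ∫ x, f x * K f x * w x ∂μ)
    (hunit : ∀ x, K (fun _ => (1 : ℝ)) x = 1) {θ : ℝ} (hθ : 0 ≤ θ)
    (hPoinc : ∀ ⦃v : X → ℝ⦄, A v → ∫ x, v x * w x ∂μ = 0 →
      ∫ x, v x * K v x * w x ∂μ ≤ θ * ∫ x, v x ^ 2 * w x ∂μ)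
    {u : X → ℝ} (hu : A u) (hu0 : ∫ x, u x * w x ∂μ = 0) :
    ∀ k : ℕ, ∫ x, u x * (K^[k] u) x * w x ∂μ ≤ θ ^ k * ∫ x, u x ^ 2 * w x ∂μ
  | 0 => by simp [sq]
  | k + 1 => by
    have h1 := autocov_succ_le_mul_of_poincare_of_pos hw0 hA1 hAi hAc hAK hlin hsymm hpos hunit hθ
      hPoinc hu hu0 k
    have hk := autocov_le_pow_of_poincare_of_pos hw0 hA1 hAi hAc hAK hlin hsymm hpos hunit hθ hPoinc
      hu hu0 k
    calc ∫ x, u x * (K^[k + 1] u) x * w x ∂μ ≤ θ * ∫ x, u x * (K^[k] u) x * w x ∂μ := h1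
      _ ≤ θ * (θ ^ k * ∫ x, u x ^ 2 * w x ∂μ) := mul_le_mul_of_nonneg_left hk hθ
      _ = θ ^ (k + 1) * ∫ x, u x ^ 2 * w x ∂μ := by ring

end RevOp

/-! ## The flow arm under a weight bound: geometric decorrelation of every square-integrable observable -/

section General

variable {X : Type*} [MeasurableSpace X] {μ : Measure X} [SFinite μ] {w q : X → ℝ}

/-- **THE FLOW ARM DECORRELATES EVERY SQUARE-INTEGRABLE OBSERVABLE GEOMETRICALLY UNDER A WEIGHT
BOUND**: `w ≤ C q`, `g` centred measurable square-integrable ⇒ for every lag `k`,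
`C_g(k) ≤ (1 − Z/C)ᵏ ∫ g² w` (`Z = ∫ w ≤ C`), i.e. `ρ_g(k) ≤ (1 − Z/C)ᵏ` — the magnetisation included. -/
theorem imhOp_autocov_le_pow_weightBound_of_sq (hw0 : ∀ t, 0 < w t) (hwm : Measurable w)
    (hwi : Integrable w μ) (hq0 : ∀ t, 0 < q t) (hqm : Measurable q) (hqi : Integrable q μ)
    (hq1 : ∫ t, q t ∂μ = 1) {C : ℝ} (hC : ∀ t, w t ≤ C * q t) {g : X → ℝ} (hgm : Measurable g)
    (hg2 : Integrable (fun t => g t ^ 2 * w t) μ) (hg0 : ∫ t, g t * w t ∂μ = 0) (k : ℕ) :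
    ∫ t, g t * ((imhOp μ w q)^[k] g) t * w t ∂μ
      ≤ (1 - (∫ t, w t ∂μ) / C) ^ k * ∫ t, g t ^ 2 * w t ∂μ := by
  have hw0' : ∀ t, 0 ≤ w t := fun t => (hw0 t).le
  have hCpos : 0 < C := by
    obtain ⟨t⟩ : Nonempty X := by
      by_contra h
      rw [not_nonempty_iff] at h
      have : ∫ t, q t ∂μ = 0 := by
        rw [Measure.eq_zero_of_isEmpty μ]; simp
      rw [this] at hq1; exact zero_ne_one hq1
    have h := hC t
    exact pos_of_mul_pos_left ((hw0 t).trans_le h) (hq0 t).le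
  -- `Z ≤ C`, so `θ = 1 − Z/C ≥ 0`
  have hZC : ∫ t, w t ∂μ ≤ C := by
    calc ∫ t, w t ∂μ ≤ ∫ t, C * q t ∂μ := integral_mono hwi (hqi.const_mul C) hC
      _ = C := by rw [integral_const_mul, hq1, mul_one]
  have hθ : 0 ≤ 1 - (∫ t, w t ∂μ) / C := by
    rw [sub_nonneg, div_le_one hCpos]; exact hZC
  have h1 : Measurable (fun _ : X => (1 : ℝ)) ∧ Integrable (fun t => (1 : ℝ) ^ 2 * w t) μ :=
    ⟨measurable_const, by simpa using hwi⟩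
  have hunit : ∀ x, imhOp μ w q (fun _ => (1 : ℝ)) x = 1 := fun x => imhOp_one hq1 x
  have hPoinc : ∀ ⦃v : X → ℝ⦄, (Measurable v ∧ Integrable (fun t => v t ^ 2 * w t) μ) →
      ∫ x, v x * w x ∂μ = 0 →
      ∫ x, v x * imhOp μ w q v x * w x ∂μ ≤ (1 - (∫ t, w t ∂μ) / C) * ∫ x, v x ^ 2 * w x ∂μ := by
    intro v hv hv0
    have h := dirichlet_ge_weightBound_of_sq hw0 hwm hwi hq0 hqm hqi hq1 hC hv.1 hv.2 hv0
    linarith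
  exact RevOp.autocov_le_pow_of_poincare_of_pos (A := fun f : X → ℝ => Measurable f ∧
      Integrable (fun t => f t ^ 2 * w t) μ) (K := imhOp μ w q) hw0' h1 (sqClass_int hw0 hwm)
    (sqClass_comb hw0 hwm) (sqClass_stab hw0 hwm hwi hq0 hqm hqi hq1)
    (sqClass_lin hw0 hwm hwi hq0 hqm hqi) (sqClass_symm hw0 hwm hwi hq0 hqm hqi hq1)
    (sqClass_pos hw0 hwm hwi hq0 hqm hqi hq1) hunit hθ hPoinc ⟨hgm, hg2⟩ hg0 k

end General

end Summit.Ventures.LatticeQCDFlow.Exactness
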